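import Literature.MathematicalPhysics.QuantumFieldTheory.Balaban1983to89.B1Eq324BenfattoClassSectEMemberPrecisionDoorGamma0AtOne
import Literature.MathematicalPhysics.QuantumFieldTheory.Balaban1983to89.B9PinMemberStarSupportSeparation

/-!
# `Balaban1983to89.B1Eq324BenfattoClassSectEMemberPrecisionDoorGamma0AtOneStar` — the `γ₀` row of [4] (2.153) ∕ [Balaban1985BackgroundPropagators] (3.156) at
# `U = 1` holds at NODE 00's letters on PRINT's STAR subspace in node00-def-Y's interim spelling VERBATIM — the scalar row `hrow` of dag-n08-d's
# `ineq2153_one_of_scalarRow_star` ∕ `ineq2153_one_lettersYOfRecordV4_of_scalarRow_star` DISCHARGED, `γ₀ = (1∕(12(d+1)²))·L^{−(d+2)}` member-uniform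

statement-level companion of published sources with citation tags; every declaration here is a theorem; nothing here is a claim about the Yang–Mills mass gap.

THE PRINT.  [Balaban1985BackgroundPropagators] p. 427: *«We assume that Λ ⊂ Λ_k = Ω_k^{(k)} is a union of big blocks, and a distance between Λ and Λ_kᶜ is
bigger than RM»* (`MemberY.hΛsep`); p. 428: *«{B : B = 0 on Λᶜ, B = 0 on ⋃_{y∈Λ′} Ax(y), Q₁B = 0} … C\*Δ_kC with a lower bound γ₀ > 0 independent of k and U.
We have proved it in [4], Lemma 2.4, for operators with U = 1»*; [Balaban1984PropagatorsII] (2.2) p. 224 *«(L^jη)⁻¹dist(Ω_jᶜ, Ω_{j+1}) > RM»*, (2.3) p. 224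
(star convention), (2.153) p. 249.

WHY THIS FILE (cell `pub-ymgap`, D-0062; seat dag-n08-b gen 36, CLAIM-16 (C′)).  `…PrecisionDoorGamma0AtOne.scalarRow_starOm` proves the row on the star
subspace with the variables' sources in `Ω_k^{(k)}` displayed (the clause def-Y's (125)-reading `readUY` presupposes).  In print that clause is automatic: a
bond whose target block is good has its source block within one unit step of `Λ`, and (2.2)∕p. 427 keep `Λ` at torus distance `> R·M·Lᵏ ≥ 2·Lᵏ` (fine units)
from every site of level `< k` — proved on NODE 00's carriers in the light member-geometry file `B9PinMemberStarSupportSeparation` (INTENT-17a, the venue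
node00-def-Y asked for so that its star edition can import it); THIS FILE discharges dag-n08-d's STAR binder verbatim — the `U = 1` Δ_k-row of NODE 00's letters on
print's subspace in the spelling node00-def-Y's WORD-L fixed for the interim (`lvl q = k ∧ (GoodY (usrc q) ∨ GoodY (utgt q))`; all `IsCornerY` corners; `IsAxialY`).

WHAT IS PROVED (0 `sorry`, 0 `def`, standard axioms; member `x`).
* (v1.1) §2 ★ `ineq2153_one_lettersYOfRecordV4_of_full` (on a FULL member — every unit site good, `Λ′ = T^{(k+1)}` — def-Y's `inΛY ∕ CBondY` subspace IS print's, so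
  p683587 §2's row `h2153` follows); ★★★ **`eq324_CsDeltaCPY_opsYOfRecordV8E_trBasis_one_of_full_on_unit` — THE (3.24) PRECISION DOOR AT `U = 1` FOR FULL MEMBERS
  WITH NO ANALYTIC ROW LEFT** (p683587 §2 with (2.153) DISCHARGED, `γ₀ = (1∕(12(d₆+1)²))·L^{−(d₆+2)}`; hypotheses left: scalars, `2 ≤ d₆+1`, `4 ≤ ℓ₆`, the member
  threshold `M₆`, fullness, an injective `Λ̃`-frame); ★ `exists_full_member` (non-vacuity: full members above any `M`, every `k ≥ 2`, at `L = 5`).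
* ★★★ **`scalarRow_star`** — dag-n08-d's `hrow` binder of `…_of_scalarRow_star` with `γ₀ = (1∕(12(d+1)²))·L^{−(d+2)}`: for every real bond function `g` with
  `g = 0` unless «`lvl q = k ∧ (GoodY (usrc q) ∨ GoodY (utgt q))`», `g = 0` on `IsAxialY`, `(Q(1)g)(c) = 0` at every `IsCornerY` corner,
  **`γ₀·Σ g² ≤ etaDY x·Σ_q g·(onFun EE g − w·g)`**; ★★★ `ineq2153_one_star` (the matrix row at any `𝔏` with `𝔏.QG1Qinv 1 = liftEndY (onFun EE)`) and ★★★
  `ineq2153_one_lettersYOfRecordV4_star` (at the v4 letters of record) — dag-n08-d's `_star` theorems with `hrow` supplied.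

HONEST SCOPE.  Count-neutral; `U = 1`; the door p683587 §2 is NOT re-keyed (its `C(1)` serves the both-good constraints — node00-def-Y's star edition); the
IDENT for row `h324c` is NOT made; node N06 ∕ N08 NOT discharged; nothing continuum ∕ OS ∕ mass gap ∕ Clay.
-/

noncomputable section

open Finset Matrix
open scoped Matrix.Norms.L2Operator

namespace Literature.MathematicalPhysics.QuantumFieldTheory.Balaban1983to89.B1Eq324BenfattoClassSectEMemberPrecisionDoorGamma0AtOneStar

open Literature.MathematicalPhysics.QuantumFieldTheory
open Literature.MathematicalPhysics.QuantumFieldTheory.Balaban1983to89.Node00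
open Literature.MathematicalPhysics.QuantumFieldTheory.Balaban1983to89.B9Thm311ReadingCoords (trIP)
open B9PinMembersKLevelV1 (MemberY)
open B6SectAVectorModelV1 (EE)
open B6GlobalChartV1 (PV domT)
open B6Ineq2133TwoScaleV1 (onFun)
open B6Ineq2142KLevelV1 (lvl)
open B9PinMemberStarSupportSeparation (starSupport_imp_starOmSupport)
open B1Eq324BenfattoClassSectEMemberPrecisionDoorGamma0AtOne (scalarRow_starOm)
open B1Eq324BenfattoClassSectEMemberIneq2153ScalarReductionAtNode00 (ineq2153_one_of_scalarRow_star
  ineq2153_one_lettersYOfRecordV4_of_scalarRow_star)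

variable {d ℓ : ℕ} {hd : 1 ≤ d + 1} {hL : Odd (ℓ + 1) ∧ 1 < ℓ + 1} {b₀ b₁ : ℝ} {Mstar : ℕ}
variable (x : MemberY d ℓ hd hL b₀ b₁ Mstar)

/-! ## ★★★ The scalar and matrix Δ_k-rows on PRINT's STAR subspace in node00-def-Y's interim spelling (dag-n08-d's `_star` binder) -/

/-- ★★★ **THE SCALAR Δ_k-ROW AT `U = 1` ON PRINT's STAR SUBSPACE, node00-def-Y's INTERIM SPELLING** (dag-n08-d's `hrow` of `…_of_scalarRow_star`, discharged):
`γ₀ = (1∕(12(d+1)²))·L^{−(d+2)}`. [cite: Balaban1984PropagatorsII, (2.153) p.249, (2.3) p.224, Lemma 2.4 p.245; Balaban1985BackgroundPropagators, (3.156) p.428, p.428 («γ₀ > 0 independent of k … [4], Lemma 2.4, for … U = 1»)] -/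
theorem scalarRow_star (hd1 : 1 ≤ d) (g : IBondY x.toKIdx → ℝ)
    (hZ : ∀ q : IBondY x.toKIdx, ¬ (lvl x.hN x.D x.hk q = x.k ∧ (GoodY x (usrc x q) ∨ GoodY x (utgt x q))) → g q = 0)
    (hAx : ∀ q, IsAxialY x q → g q = 0)
    (hQ : ∀ c : USiteY x × Fin (d + 1), IsCornerY x c.1 →
      Q1Y x (avYOfRecord x) (fun _ _ => 1 : CfgY ℂ x.toKIdx) c (fun q => ((g q : ℝ) : ℂ)) = 0) :
    1 / (12 * (((d + 1 : ℕ) : ℝ)) ^ 2) * ((((ℓ + 1 : ℕ) : ℝ)) ^ (d + 2))⁻¹ * ∑ q, g q ^ 2 ≤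
      etaDY x * ∑ q, g q * (onFun (EE (domT x.hN x.D x.hk) x.hcf x.hw) g q - x.toKIdx.w q * g q) :=
  scalarRow_starOm x hd1 g (fun q hq => hZ q fun h => hq (starSupport_imp_starOmSupport x q h)) hAx hQ

variable {N : ℕ}

/-- ★★★ **THE MATRIX Δ_k-ROW, STAR SUBSPACE** (dag-n08-d `ineq2153_one_of_scalarRow_star` with its `hrow` supplied).
[cite: Balaban1985BackgroundPropagators, (3.156) p.428, Cor. 3.5 p.407; Balaban1984PropagatorsII, (2.153) p.249] -/
theorem ineq2153_one_star (hd1 : 1 ≤ d) (𝔏 : CovLettersY (Matrix (Fin N) (Fin N) ℂ) x) (𝔢 : SectELettersY (Matrix (Fin N) (Fin N) ℂ) x)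
    (hT : 𝔏.QG1Qinv (fun _ _ => 1) = liftEndY (Matrix (Fin N) (Fin N) ℂ) (onFun (EE (domT x.hN x.D x.hk) x.hcf x.hw)))
    (B : IBondY x.toKIdx → Matrix (Fin N) (Fin N) ℂ)
    (hΛ : ∀ q, ¬ (lvl x.hN x.D x.hk q = x.k ∧ (GoodY x (usrc x q) ∨ GoodY x (utgt x q))) → B q = 0) (hAx : ∀ q, IsAxialY x q → B q = 0)
    (hQ : ∀ c : USiteY x × Fin (d + 1), IsCornerY x c.1 →
      Q1Y x (avYOfRecord x) (fun _ _ => 1 : CfgY (Matrix (Fin N) (Fin N) ℂ) x.toKIdx) c B = 0) :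
    1 / (12 * (((d + 1 : ℕ) : ℝ)) ^ 2) * ((((ℓ + 1 : ℕ) : ℝ)) ^ (d + 2))⁻¹ * trIP (fun _ => (1 : ℝ)) B B ≤
      trIP (fun _ => (1 : ℝ)) B (deltaKPY x 𝔏 𝔢 (fun _ _ => 1) B) :=
  ineq2153_one_of_scalarRow_star x 𝔏 𝔢 _ hT (scalarRow_star x hd1) B hΛ hAx hQ

section Record

variable (N) (θ : Stage3Params) (Mstar' : ℕ) (𝔯 : ResY N θ Mstar')

/-- ★★★ **THE MATRIX Δ_k-ROW AT THE v4 LETTERS OF RECORD, STAR SUBSPACE** (dag-n08-d `ineq2153_one_lettersYOfRecordV4_of_scalarRow_star` with its `hrow`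
supplied; any residual family `𝔯`, any Sect. E letters `𝔢`). [cite: Balaban1985BackgroundPropagators, (3.156) p.428, (3.132) p.422; Balaban1984PropagatorsII, (2.153) p.249] -/
theorem ineq2153_one_lettersYOfRecordV4_star (hD : 2 ≤ θ.d₆ + 1) (x : MemberY θ.d₆ θ.ℓ₆ θ.hd' θ.hL' θ.b₀ θ.b₁ Mstar')
    (𝔢 : SectELettersY (Matrix (Fin N) (Fin N) ℂ) x) (B : IBondY x.toKIdx → Matrix (Fin N) (Fin N) ℂ)
    (hΛ : ∀ q, ¬ (lvl x.hN x.D x.hk q = x.k ∧ (GoodY x (usrc x q) ∨ GoodY x (utgt x q))) → B q = 0) (hAx : ∀ q, IsAxialY x q → B q = 0)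
    (hQ : ∀ c : USiteY x × Fin (θ.d₆ + 1), IsCornerY x c.1 →
      Q1Y x (avYOfRecord x) (fun _ _ => 1 : CfgY (Matrix (Fin N) (Fin N) ℂ) x.toKIdx) c B = 0) :
    1 / (12 * (((θ.d₆ + 1 : ℕ) : ℝ)) ^ 2) * ((((θ.ℓ₆ + 1 : ℕ) : ℝ)) ^ (θ.d₆ + 2))⁻¹ * trIP (fun _ => (1 : ℝ)) B B ≤
      trIP (fun _ => (1 : ℝ)) B (deltaKPY x (lettersYOfRecordV4 N θ Mstar' 𝔯 x) 𝔢 (fun _ _ => 1) B) :=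
  ineq2153_one_lettersYOfRecordV4_of_scalarRow_star N θ Mstar' 𝔯 x 𝔢 (scalarRow_star x (by omega)) B hΛ hAx hQ

end Record

/-! ## §2 (v1.1) ★★★ THE `U = 1` DOOR WITH NO ANALYTIC ROW LEFT, FOR FULL MEMBERS (`Λ′` = the whole unit torus: the all-small-field history) -/

section FullDoor

open B9PinGeometryKLevelV1 (inΛY inΛY_top)
open B9PinMembersKLevelV1 (geo9Y)
open B9CoReadingCoordsTranspose (trReForm TrIdx trBasis)
open Literature.MathematicalPhysics.QuantumFieldTheory.Balaban1983to89.B1Eq324BenfattoLemma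
open B1Eq324BenfattoClassSectEMemberPrecisionDoorIneq2153AtOne (eq324_CsDeltaCPY_opsYOfRecordV8E_trBasis_one_of_ineq2153_on_unit)
open MeasureTheory

variable (N : ℕ) (θ : Stage3Params) (Mstar' : ℕ) (𝔯 : ResY N θ Mstar')

/-- ★ **ON A FULL MEMBER, def-Y's CURRENT CONSTRAINED SUBSPACE IS PRINT's**: if every unit site is good, a field vanishing off `inΛY` vanishes off the star support,
and every `L`-corner bond is both-good (`CBondY`) — so the row `h2153` of p683587 §2 on def-Y's subspace FOLLOWS from the star row (`ineq2153_one_lettersYOfRecordV4_star`).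
[cite: Balaban1985BackgroundPropagators, (3.156) p.428; Balaban1984PropagatorsII, (2.153) p.249 («on the whole lattice T^{(k)}»)] -/
theorem ineq2153_one_lettersYOfRecordV4_of_full (hD : 2 ≤ θ.d₆ + 1) (x : MemberY θ.d₆ θ.ℓ₆ θ.hd' θ.hL' θ.b₀ θ.b₁ Mstar')
    (hfull : ∀ y : USiteY x, GoodY x y) (𝔢 : SectELettersY (Matrix (Fin N) (Fin N) ℂ) x) (B : IBondY x.toKIdx → Matrix (Fin N) (Fin N) ℂ)
    (hΛ : ∀ q, ¬ inΛY x q → B q = 0) (hAx : ∀ q, IsAxialY x q → B q = 0)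
    (hQ : ∀ c : CBondY x, Q1Y x (avYOfRecord x) (fun _ _ => 1 : CfgY (Matrix (Fin N) (Fin N) ℂ) x.toKIdx) c.1 B = 0) :
    1 / (12 * (((θ.d₆ + 1 : ℕ) : ℝ)) ^ 2) * ((((θ.ℓ₆ + 1 : ℕ) : ℝ)) ^ (θ.d₆ + 2))⁻¹ * trIP (fun _ => (1 : ℝ)) B B ≤
      trIP (fun _ => (1 : ℝ)) B (deltaKPY x (lettersYOfRecordV4 N θ Mstar' 𝔯 x) 𝔢 (fun _ _ => 1) B) :=
  ineq2153_one_lettersYOfRecordV4_star N θ Mstar' 𝔯 hD x 𝔢 B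
    (fun q hq => hΛ q fun hin => hq ⟨inΛY_top hin, Or.inl (hfull _)⟩) hAx
    fun c hc => hQ ⟨c, (mem_coarseY x).2 ⟨hc, hfull _, hfull _⟩⟩

/-- ★★★ **THE (3.24) PRECISION DOOR AT `U = 1` FOR FULL MEMBERS — NO ANALYTIC ROW LEFT.**  p683587 §2
`eq324_CsDeltaCPY_opsYOfRecordV8E_trBasis_one_of_ineq2153_on_unit` («(3.24) at the trivial background MODULO [4] (2.153) at NODE 00's letters alone») with its (2.153)
row DISCHARGED at every FULL member (`∀ y, GoodY x y`: `Λ′ = T^{(k+1)}`, the history with no large-field region at step `k` — there def-Y's both-good constraint index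
`CBondY` IS print's star set, so CHECK-L's obstruction is absent): for every `N`, `θ` (`2 ≤ d₆ + 1`, `4 ≤ ℓ₆`), `𝔠, 𝔡₂, 𝔢₀`, Hamiltonian scalars, there are a member
threshold `M₆` and a window bound `b₁` such that for all `b₀ > b₁`, some `C ≥ 0`, all `0 < η ≤ 1`, every FULL member `x` above `M₆` and every injective `Λ̃`-frame `ι`,
[Balaban1982Higgs1] (3.24) ∕ [BenfattoEtAl1978] (4.5)–(4.7) holds for the Gaussian `𝒩(0, 𝕄_ι(η^{d+1}C\*Δ_kC(1))⁻¹)` VERBATIM as in §3b∕§2 of the doors — with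
`γ₀ := (1∕(12(d₆+1)²))·L^{−(d₆+2)}` supplied by `ineq2153_one_lettersYOfRecordV4_star`.  HONEST: `U = 1` and full members only; members with a proper `Λ′` wait for
node00-def-Y's star letters `Λ̃ ∕ C ∕ C\*`; the IDENT for row `h324c` (NODE 00's pin) is not made; node N08 NOT discharged.
[cite: Balaban1985BackgroundPropagators, (3.156)–(3.158) p.428; Balaban1984PropagatorsII, (2.153) p.249; Balaban1982Higgs1, (3.24) p.616; BenfattoEtAl1978, Lemma (4.5)–(4.7) p.152; Balaban1985UV3, (24) p.262] -/
theorem eq324_CsDeltaCPY_opsYOfRecordV8E_trBasis_one_of_full_on_unit (N : ℕ) [NeZero N] (θ : Stage3Params) (hD : 2 ≤ θ.d₆ + 1) (hℓ : 4 ≤ θ.ℓ₆)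
    (Mstar : ℕ) (𝔠 : C2Y N θ Mstar) (𝔡₂ : Dt2Y N θ Mstar) (𝔢₀ : SectEY N θ Mstar)
    (t D : ℕ) {ϰ : ℝ} (hϰ : 0 < ϰ)
    {p₀ σ' c κ' : ℝ} (hp₀ : 2 / 3 < p₀) (hσ : 0 < σ') (hc : 0 ≤ c) (hκ : 0 < κ') (hκσ : κ' < σ' * (t + 1)) :
    ∃ M₆ b₁ : ℝ, ∀ b₀ : ℝ, b₁ < b₀ → ∃ C : ℝ, 0 ≤ C ∧ ∀ η : ℝ, 0 < η → η ≤ 1 →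
      ∀ (x : MemberY θ.d₆ θ.ℓ₆ θ.hd' θ.hL' θ.b₀ θ.b₁ Mstar) [DecidableEq (IBondY x.toKIdx)], M₆ ≤ (geo9Y x).M → (∀ y : USiteY x, GoodY x y) →
      ∀ {σ : Type} [Fintype σ] [DecidableEq σ] [Nonempty σ] (ι : σ → IBondY x.toKIdx), Function.Injective ι → (∀ s, lamTY x (ι s)) →
      ∃ (Λ : Finset (B1Eq324BenfattoLemma.Site (θ.d₆ + 1 + (θ.d₆ + 1) + 1))) (e' : σ × TrIdx N ≃ ↥Λ),
        ((gaussianFieldOfKernel fun u w => if h : u ∈ Λ ∧ w ∈ Λ then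
            ((Matrix.reindex e' e'
              (Matrix.of fun p q : σ × TrIdx N =>
                  trReForm (trBasis N p.2) (((CsDeltaCPY x (lettersYOfRecordV4 N θ Mstar (resYOfC2 N θ Mstar 𝔠) x)
            (sectEYOfRecordV6 N θ Mstar (sectEYWithDt2 N θ Mstar (resYOfC2 N θ Mstar 𝔠) 𝔡₂ 𝔢₀) x) (fun _ _ => 1)).restrictScalars ℝ)
                    (Pi.single (ι q.1) (trBasis N q.2)) (ι p.1))))⁻¹ :
                Matrix ↥Λ ↥Λ ℝ) ⟨u, h.1⟩ ⟨w, h.2⟩ else 0).map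
            (fun (z : B1Eq324BenfattoLemma.Site (θ.d₆ + 1 + (θ.d₆ + 1) + 1) → ℝ) (q : σ × TrIdx N) => z ((e' q : ↥Λ) : B1Eq324BenfattoLemma.Site (θ.d₆ + 1 + (θ.d₆ + 1) + 1))) =
          gaussianFieldOfKernel fun p q =>
            ((Matrix.of fun p q : σ × TrIdx N =>
                trReForm (trBasis N p.2) (((CsDeltaCPY x (lettersYOfRecordV4 N θ Mstar (resYOfC2 N θ Mstar 𝔠) x)
            (sectEYOfRecordV6 N θ Mstar (sectEYWithDt2 N θ Mstar (resYOfC2 N θ Mstar 𝔠) 𝔡₂ 𝔢₀) x) (fun _ _ => 1)).restrictScalars ℝ)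
                  (Pi.single (ι q.1) (trBasis N q.2)) (ι p.1)))⁻¹ :
              Matrix (σ × TrIdx N) (σ × TrIdx N) ℝ) p q) ∧
        (∀ p : ℝ, 0 ≤ p →
          ((fun (z : B1Eq324BenfattoLemma.Site (θ.d₆ + 1 + (θ.d₆ + 1) + 1) → ℝ) (q : σ × TrIdx N) => z ((e' q : ↥Λ) : B1Eq324BenfattoLemma.Site (θ.d₆ + 1 + (θ.d₆ + 1) + 1))) ⁻¹'
              {ω : σ × TrIdx N → ℝ | ∀ q, |ω q| ≤ p}) =ᵐ[gaussianFieldOfKernel fun u w => if h : u ∈ Λ ∧ w ∈ Λ then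
                ((Matrix.reindex e' e'
                  (Matrix.of fun p q : σ × TrIdx N =>
                      trReForm (trBasis N p.2) (((CsDeltaCPY x (lettersYOfRecordV4 N θ Mstar (resYOfC2 N θ Mstar 𝔠) x)
            (sectEYOfRecordV6 N θ Mstar (sectEYWithDt2 N θ Mstar (resYOfC2 N θ Mstar 𝔠) 𝔡₂ 𝔢₀) x) (fun _ _ => 1)).restrictScalars ℝ)
                        (Pi.single (ι q.1) (trBasis N q.2)) (ι p.1))))⁻¹ :
                    Matrix ↥Λ ↥Λ ℝ) ⟨u, h.1⟩ ⟨w, h.2⟩ else 0]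
            smallFieldSet Λ p) ∧
        ∀ (s : ℕ) (I J : Finset (B1Eq324BenfattoLemma.Site (θ.d₆ + 1 + (θ.d₆ + 1) + 1))) (𝔞 : Coef (θ.d₆ + 1 + (θ.d₆ + 1) + 1)),
          I.Nonempty → J ⊆ I → J ⊆ Λ → coefSup s D 𝔞 J ≤ c * η ^ σ' →
          0 < ∫ z, cutoffBoltzmann (hamiltonian s D ϰ 𝔞 J) I (B10.pFun b₀ p₀ η) z ∂(gaussianFieldOfKernel fun u w => if h : u ∈ Λ ∧ w ∈ Λ then
              ((Matrix.reindex e' e'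
                (Matrix.of fun p q : σ × TrIdx N =>
                    trReForm (trBasis N p.2) (((CsDeltaCPY x (lettersYOfRecordV4 N θ Mstar (resYOfC2 N θ Mstar 𝔠) x)
            (sectEYOfRecordV6 N θ Mstar (sectEYWithDt2 N θ Mstar (resYOfC2 N θ Mstar 𝔠) 𝔡₂ 𝔢₀) x) (fun _ _ => 1)).restrictScalars ℝ)
                      (Pi.single (ι q.1) (trBasis N q.2)) (ι p.1))))⁻¹ :
                  Matrix ↥Λ ↥Λ ℝ) ⟨u, h.1⟩ ⟨w, h.2⟩ else 0) ∧
            |Real.log (∫ z, cutoffBoltzmann (hamiltonian s D ϰ 𝔞 J) I (B10.pFun b₀ p₀ η) z ∂(gaussianFieldOfKernel fun u w =>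
                if h : u ∈ Λ ∧ w ∈ Λ then
                  ((Matrix.reindex e' e'
                    (Matrix.of fun p q : σ × TrIdx N =>
                        trReForm (trBasis N p.2) (((CsDeltaCPY x (lettersYOfRecordV4 N θ Mstar (resYOfC2 N θ Mstar 𝔠) x)
            (sectEYOfRecordV6 N θ Mstar (sectEYWithDt2 N θ Mstar (resYOfC2 N θ Mstar 𝔠) 𝔡₂ 𝔢₀) x) (fun _ _ => 1)).restrictScalars ℝ)
                          (Pi.single (ι q.1) (trBasis N q.2)) (ι p.1))))⁻¹ :
                      Matrix ↥Λ ↥Λ ℝ) ⟨u, h.1⟩ ⟨w, h.2⟩ else 0)) -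
              cumulantSum (gaussianFieldOfKernel fun u w => if h : u ∈ Λ ∧ w ∈ Λ then
                  ((Matrix.reindex e' e'
                    (Matrix.of fun p q : σ × TrIdx N =>
                        trReForm (trBasis N p.2) (((CsDeltaCPY x (lettersYOfRecordV4 N θ Mstar (resYOfC2 N θ Mstar 𝔠) x)
            (sectEYOfRecordV6 N θ Mstar (sectEYWithDt2 N θ Mstar (resYOfC2 N θ Mstar 𝔠) 𝔡₂ 𝔢₀) x) (fun _ _ => 1)).restrictScalars ℝ)
                          (Pi.single (ι q.1) (trBasis N q.2)) (ι p.1))))⁻¹ :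
                      Matrix ↥Λ ↥Λ ℝ) ⟨u, h.1⟩ ⟨w, h.2⟩ else 0)
                (hamiltonian s D ϰ 𝔞 J) t| ≤ C * η ^ κ' * I.card := by
  have hγ₀ : (0 : ℝ) < 1 / (12 * (((θ.d₆ + 1 : ℕ) : ℝ)) ^ 2) * ((((θ.ℓ₆ + 1 : ℕ) : ℝ)) ^ (θ.d₆ + 2))⁻¹ := by positivity
  obtain ⟨M₆, b₁, H⟩ := eq324_CsDeltaCPY_opsYOfRecordV8E_trBasis_one_of_ineq2153_on_unit N θ hD hℓ Mstar 𝔠 𝔡₂ 𝔢₀ hγ₀ t D hϰ hp₀ hσ hc hκ hκσ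
  refine ⟨M₆, b₁, fun b₀ hb₀ => ?_⟩
  obtain ⟨C, hC, hE⟩ := H b₀ hb₀
  refine ⟨C, hC, ?_⟩
  intro η hη hηle x _ hMx hfull σ _ _ _ ι hι hιT
  exact hE η hη hηle x hMx ι hι hιT fun B hΛ hAx hQ =>
    ineq2153_one_lettersYOfRecordV4_of_full N θ Mstar (resYOfC2 N θ Mstar 𝔠) hD x hfull _ B hΛ hAx hQ

/-- ★ **NON-VACUITY: FULL MEMBERS EXIST** (above any prescribed `M`, every `k ≥ 2`, at `L = 5`, band `0 < b₀ ≤ b₁`): the constant-level member of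
`B9PinMembersKLevelV1.kIdx_topConst_L5` (`Ω_k = T_η`) with `Λ := T_η` — every unit site is good (`iterBlockOf k ∘ embIter k = id`).  (Other odd `L ≥ 7` place no
top cubes in the tree's V1 chart, `memberY_exists_nonempty_Λ`'s located note; the door above asks `4 ≤ ℓ`, met here with `ℓ = 4`.)
[cite: Balaban1985BackgroundPropagators, p.427 («Λ ⊂ Λ_k = Ω_k^{(k)} is a union of big blocks»), Thm 3.15 p.432 (non-vacuity of the typed datum)] -/
theorem exists_full_member {d ℓ : ℕ} {hd : 1 ≤ d + 1} {hL : Odd (ℓ + 1) ∧ 1 < ℓ + 1} {b₀ b₁ : ℝ} {Mstar : ℕ}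
    (hℓ : 4 ≤ ℓ) (hℓ4 : ℓ ≤ 4) {k : ℕ} (hk : 2 ≤ k) (hb₀ : 0 < b₀) (hb₁ : b₀ ≤ b₁) (M₂ : ℝ) :
    ∃ x : MemberY d ℓ hd hL b₀ b₁ Mstar, x.k = k ∧ M₂ ≤ (geo9Y x).M ∧ ∀ y : USiteY x, GoodY x y := by
  obtain ⟨i, hik, hcf, hM, hlev⟩ := B9PinMembersKLevelV1.kIdx_topConst_L5 (d := d) (hd := hd) (hL := hL) hℓ hℓ4 hk hb₀ hb₁ (max M₂ (Mstar : ℝ))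
  have hMstar : Mstar ≤ (ℓ + 1) * i.Mh := by
    have h : (Mstar : ℝ) ≤ ((ℓ + 1 : ℕ) : ℝ) * (i.Mh : ℝ) := (le_max_right _ _).trans hM
    exact_mod_cast h
  have hlev' : ∀ z, i.D.lev z = i.k := fun z => (hlev z).trans hik.symm
  refine ⟨{ toKIdx := i, hcfk := hcf, hMstar := hMstar, D' := i.D, hpl' := i.hpl, w' := i.w, hw' := i.hw, hwb' := i.hwb,
            Λ := Set.univ, hΛlev := fun z _ => hlev' _, hΛblocks := fun _ _ _ => by simp,
            hΛsep := fun z _ z' h => absurd h (by rw [hlev']; exact lt_irrefl _) }, hik, (le_max_left _ _).trans hM, fun y u _ => ?_⟩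
  exact ⟨B15DeterminingSets.embIter i.k u, Set.mem_univ _, iterBlockOf_embIter i.k i.hk u⟩

end FullDoor

end Literature.MathematicalPhysics.QuantumFieldTheory.Balaban1983to89.B1Eq324BenfattoClassSectEMemberPrecisionDoorGamma0AtOneStar

end
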